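import Mathlib
import Summits.ResolutionOfSingularities.ResolutionOfSingularities.Theorems.RadicialJungCleanModelsContactChain
import Summits.ResolutionOfSingularities.ResolutionOfSingularities.Theorems.RadicialJungCleanModelsChargedLanding
import Literature.AlgebraicGeometry.Resolution.TransverseCentreEffectiveCartier
import Literature.AlgebraicGeometry.Motives.CartierDivisor
import HarnessLib

/-!
# Route `RadicialJung`, crux `CleanModels` (stmt-ResolutionOfSingularities-15917), line `Sketch` rev 20, stub 4e
# `stub_cleanPrincipalization3`: L7b PHASE 1 ASSEMBLED — along a chain of `k` point blowing ups a tangent clean component is used up, and at a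
# CHARGED landing the strict transform of the curve is CLEAN-PERMISSIBLE

Memo `Cruxes/CleanModels/Lines/Sketch-memo-4e-cleanPermissible.md` rev 11.3 §2.3 `(μ,1)` (a) / rev 10 §3 (L7b phase 1) / [CJS 2020] Thm 6.28
«first cycle».  THE STATEMENT (one old charged component `V(s)` NOT containing the regular curve `C₀`, contact `k ≥ 0` at the closed point
`x₀ = σ x`): if the line of `G` at `x₀` is presented as `Σ_j c_j^p G^j = u₀ · s^a` with `s = γ w^k + s₀` in contact normal form
(`exists_contact_normalForm`, ✓ p691423) and `X₀ ← ⋯ ← X` is ANY chain of `k` point blowing ups following the curve (`IsPointChainAlong`,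
✓ p691777; such chains exist, `ContactChainExists.lean`), then at the end point `x ∈ C` (the `k`-th strict transform) the line of `σ^♯ G`
is presented as `(unit) · e^{k a}` with `e` transversal to `C` (`contact_along_pointChain`), hence — if the landing exceptional divisor is
CHARGED, `p ∤ k a` — CLEAN-PERMISSIBLE for the centre `C` (`cleanPermissibleAt_of_chargedLanding`, ✓ p692062).  The function-field
bookkeeping is `RatFn.functionFieldMap_toFunctionField`.
* `cleanPermissibleAt_of_pointChain_chargedLanding`.
What is NOT here (rest of work plan W3 / O8): the uncharged landing (`p ∣ k a`: form (2) is ✓ `cleanPermissibleAt_of_unit`, form (3) starts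
phase 2), several old components through `x₀` (`m ≥ 2` starts), and components containing the curve.

Honest framing: OURS; nothing here proves resolution in characteristic `p` or any case of `CleanModels`.
-/

noncomputable section

set_option linter.dupNamespace false -- mandated namespace of this single-conjunct summit

open CategoryTheory AlgebraicGeometry TopologicalSpace IsLocalRing
open Literature.AlgebraicGeometry.Resolution Literature.AlgebraicGeometry.Motives
open Scheme.IdealSheafData

universe u

namespace Summit.ResolutionOfSingularities.ResolutionOfSingularities.Theorems.RadicialJung.CleanModels

/-- **L7b phase 1, charged landing.**  See the module docstring. [cite: CossartJannsenSaito2020, proof of Thm. 6.28, Step 5]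
[cite: CossartPiltant2008, Prop. 4.4 (proof, p. 10)] -/
theorem cleanPermissibleAt_of_pointChain_chargedLanding {X₀ X : Scheme.{u}} [IsIntegral X₀] [IsIntegral X] {σ : X ⟶ X₀}
    [IsDominant σ] {C₀ : Closeds X₀} {C : Closeds X} {x : X} {k : ℕ} (h : IsPointChainAlong σ C₀ C x k)
    [IsLocallyNoetherian X₀] [IsLocallyNoetherian X] (hX₀ : Scheme.IsRegular X₀)
    (hC₀reg : ∀ y ∈ (C₀ : Set X₀), ∃ c : Fin 2 → X₀.presheaf.stalk y,
      IsRsopPart c ∧ Ideal.span (Set.range c) = stalkIdeal (vanishingIdeal C₀) y)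
    (hxC₀ : σ x ∈ (C₀ : Set X₀)) (hdim₀ : ringKrullDim (X₀.presheaf.stalk (σ x)) = 3)
    (p : ℕ) (G : X₀.functionField) (cc : Fin p → X₀.functionField) (hcc : ∃ j : Fin p, (j : ℕ) ≠ 0 ∧ cc j ≠ 0)
    (w γ s₀ u₀ : X₀.presheaf.stalk (σ x)) (hw : stalkIdeal (vanishingIdeal C₀) (σ x) ⊔ Ideal.span {w} = maximalIdeal _)
    (hγ : IsUnit γ) (hs₀ : s₀ ∈ stalkIdeal (vanishingIdeal C₀) (σ x)) (hu₀ : IsUnit u₀) (a : ℕ) (hpka : ¬ p ∣ k * a)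
    (hX : (∑ j : Fin p, cc j ^ p * G ^ (j : ℕ)) = RatFn.toFunctionField (σ x) (u₀ * (γ * w ^ k + s₀) ^ a)) :
    CleanPermissibleAt p (RatFn.toFunctionField x) (RatFn.functionFieldMap σ G) (stalkIdeal (vanishingIdeal C) x) := by
  obtain ⟨hXreg, hCreg, hxC, hdim, e, c, ω, γ', π', he, hc, -, hγ', hπ', -, hsimg⟩ :=
    contact_along_pointChain h hX₀ hC₀reg hxC₀ hdim₀ w γ s₀ hw hγ hs₀ k le_rfl
  -- the local rings at `x`
  haveI : IsRegularLocalRing (X.presheaf.stalk x) := hXreg x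
  obtain ⟨c2, hc2, hspan⟩ := hCreg x hxC
  haveI : IsRegularLocalRing (X.presheaf.stalk x ⧸ stalkIdeal (vanishingIdeal C) x) := by
    rw [← hspan]; exact hc2.isRegularLocalRing_quotient
  have hP1 : ringKrullDim (X.presheaf.stalk x ⧸ stalkIdeal (vanishingIdeal C) x) = 1 := by
    rw [← hspan]; exact ringKrullDim_quotient_span_pair_eq_one hc2 hdim
  have hPle : stalkIdeal (vanishingIdeal C) x ≤ maximalIdeal _ := le_sup_left.trans he.le
  -- the residual factor is a unit: the old component has left the curve
  rw [Nat.sub_self, pow_zero, mul_one] at hsimg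
  have hunit : IsUnit (γ' + π') := by
    by_contra hnu
    have hm : γ' + π' ∈ maximalIdeal (X.presheaf.stalk x) := (mem_maximalIdeal _).mpr hnu
    have h2 : γ' + π' - π' ∈ maximalIdeal (X.presheaf.stalk x) := Ideal.sub_mem _ hm (hPle hπ')
    rw [add_sub_cancel_right] at h2
    exact (mem_maximalIdeal _).mp h2 hγ'
  -- the unit `U` and the presentation `U · e^{k a}` upstairs
  set U : X.presheaf.stalk x := (σ.stalkMap x).hom u₀ * (c * (γ' + π')) ^ a with hU
  have hUunit : IsUnit U := (hu₀.map _).mul ((hc.mul hunit).pow a)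
  have himg : (σ.stalkMap x).hom (u₀ * (γ * w ^ k + s₀) ^ a) = U * e ^ (k * a) := by
    simp only [map_mul, map_pow, hsimg, hU, mul_pow, ← pow_mul]
    ring
  have hX' : (∑ j : Fin p, (RatFn.functionFieldMap σ (cc j)) ^ p * (RatFn.functionFieldMap σ G) ^ (j : ℕ)) =
      RatFn.toFunctionField x (U * e ^ (k * a)) := by
    calc (∑ j : Fin p, (RatFn.functionFieldMap σ (cc j)) ^ p * (RatFn.functionFieldMap σ G) ^ (j : ℕ))
        = RatFn.functionFieldMap σ (∑ j : Fin p, cc j ^ p * G ^ (j : ℕ)) := by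
          rw [map_sum]; simp only [map_mul, map_pow]
      _ = RatFn.functionFieldMap σ (RatFn.toFunctionField (σ x) (u₀ * (γ * w ^ k + s₀) ^ a)) := by rw [hX]
      _ = RatFn.toFunctionField x ((σ.stalkMap x) (u₀ * (γ * w ^ k + s₀) ^ a)) :=
          RatFn.functionFieldMap_toFunctionField σ x _
      _ = RatFn.toFunctionField x (U * e ^ (k * a)) := congrArg (RatFn.toFunctionField x) himg
  have hcc' : ∃ j : Fin p, (j : ℕ) ≠ 0 ∧ RatFn.functionFieldMap σ (cc j) ≠ 0 := by
    obtain ⟨j, hj, hj0⟩ := hcc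
    exact ⟨j, hj, fun h0 => hj0 ((RatFn.functionFieldMap σ).injective (by rw [h0, map_zero]))⟩
  exact cleanPermissibleAt_of_chargedLanding p (RatFn.toFunctionField x) (RatFn.functionFieldMap σ G) _ hP1 _ hcc' e he (k * a)
    hpka U hUunit hX'

end Summit.ResolutionOfSingularities.ResolutionOfSingularities.Theorems.RadicialJung.CleanModels

end
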